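import Mathlib
import HarnessLib.Audit
import Summits.PneNP.PneNP.Theorems.PstarChordReadTwoChords
import Summits.PneNP.PneNP.Theorems.PstarMaxSharingReaders

/-!
# Tight terminal cores have no two slice-generic chords (ROUND-24, O1 at exact tightness; memo g21 §16.6)

FRONTIER range-avoidance ladder, rung F-N3, ROUND 24 (cell `pnp-ideate`, prover-2 memos `g19/O1-CHORD-READ.md` §4 / §6.3 (TIGHT CHORD EXCLUSION),
`g21/O1-CHORD-READ-g21.md` §16.6; planner sketch `r24/SketchTightChordFree.lean`; typed target `PstarCoreBoundTargets.TerminalPeelable` (p646951);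
restricted-model proof complexity — nothing here bears on `P` versus `NP`).

The two structural hypotheses of the two-chord theorem (`PstarChordReadTwoChords.false_of_two_gated`) are AUTOMATIC for a TIGHT core
(`2·#bdry J₀ ≤ 3·#J₀` — e.g. at maximal sharing, `PstarMaxSharingReaders.two_mul_card_bdry_le_of_maxSharing`; all 1800 tight `k = 12` O1
structures):

* `bdry_insert_subset_gen` / `card_bdry_insert_le_gen` — boundary bookkeeping for adding one output: `#bdry(X + g) + 2·#T ≤ #bdry X + 4` for any
  `T ⊆ varSet g ∩ bdry X`;
* `outsideGated_of_tight` — every monomial touching a chord's AND pair is an outside gate (`PstarMaxSharingReaders.partner_fresh_of_tight`);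
* `no_shared_partner_of_tight` — two chords never share a partner: the two gates would cost `#bdry ≤ #bdry J₀ + 2` for `#J₀ + 2` outputs, against
  `(r,3/2)`-expansion;
* **`false_of_tight_two_generic`** — a TIGHT terminal core has no two distinct SLICE-GENERIC chords (any readers);
  `false_of_maxSharing_two_generic` — in particular at maximal sharing (`2·#sharedSlots = #J₀`, the regime of `TerminalFiveMaxSharing`).

With the per-chord certificate (kit j314774: on every tight `k = 12` O1 structure at least five of the six chords are slice-generic for every fibre
class) this is the statement "no tight `k = 12` O1 structure carries a terminal configuration"; the kernel part is complete, the certificate is not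
a kernel object.  No Assumption A.
-/

set_option linter.dupNamespace false -- `Summit.PneNP.PneNP.…`: summit = sub-problem name (D-0017 single-conjunct layout)

open Finset Literature.Computability.Complexity
open Summit.PneNP.PneNP.Theorems.PstarTyped (Typed)
open Summit.PneNP.PneNP.Theorems.PstarSALevel (varSet bdry BoundaryExpanding SimpleOverlap)
open Summit.PneNP.PneNP.Theorems.PstarSAClosure (card_varSet_le)
open Summit.PneNP.PneNP.Theorems.PstarGapPeeling (not_mem_varSet_of_private)
open Summit.PneNP.PneNP.Theorems.PstarCentreFree (vars_mem_varSet)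
open Summit.PneNP.PneNP.Theorems.PstarCoreBound (XorClosed)
open Summit.PneNP.PneNP.Theorems.PstarChordRepair (IsChord)
open Summit.PneNP.PneNP.Theorems.PstarCoreBoundTargets (Terminal)
open Summit.PneNP.PneNP.Theorems.PstarSharingBound (sharedSlots)
open Summit.PneNP.PneNP.Theorems.PstarMaxSharingReaders (partner_fresh_of_tight exists_mem_of_mem_bdry two_mul_card_bdry_le_of_maxSharing)
open Summit.PneNP.PneNP.Theorems.PstarGateUnit (mem_bdry_of_unique)
open Summit.PneNP.PneNP.Theorems.PstarNorCoreTools (eq_of_mem_bdry)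
open Summit.PneNP.PneNP.Theorems.PstarChordReadLemma (SliceGeneric)
open Summit.PneNP.PneNP.Theorems.PstarChordReadSwitches (Touches)
open Summit.PneNP.PneNP.Theorems.PstarChordReadOutside
open Summit.PneNP.PneNP.Theorems.PstarChordReadTwoChords

namespace Summit.PneNP.PneNP.Theorems.PstarChordReadTight

variable {n m : ℕ}

/-! ## Boundary bookkeeping for one inserted output -/
section Bdry

variable (I : LocalMap 4 n m)

/-- **Boundary of `X + g`**: a boundary variable of `X + g` is either a boundary variable of `X` not read by `g`, or a variable of `g` read by no
member of `X`. -/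
theorem bdry_insert_subset_gen {X : Finset (Fin m)} {g : Fin m} (hg : g ∉ X) :
    bdry I (insert g X) ⊆ (bdry I X \ varSet I g) ∪ (varSet I g).filter (fun w => ∀ j ∈ X, w ∉ varSet I j) := by
  classical
  intro w hw
  have hw' := hw
  unfold PstarSALevel.bdry at hw'
  rw [mem_filter, card_eq_one] at hw'
  obtain ⟨j, hj⟩ := hw'.2
  have hjm : j ∈ (insert g X).filter fun j => w ∈ varSet I j := by rw [hj]; exact mem_singleton_self j
  rw [mem_filter] at hjm
  obtain ⟨hjF, hwj⟩ := hjm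
  have huniq : ∀ j' ∈ insert g X, w ∈ varSet I j' → j' = j := fun j' hj' hwj' => eq_of_mem_bdry I hj' hjF hw hwj' hwj
  by_cases hwg : w ∈ varSet I g
  · refine mem_union_right _ (mem_filter.2 ⟨hwg, fun j' hj'X hwj' => ?_⟩)
    have hjg : g = j := huniq g (mem_insert_self g X) hwg
    have := huniq j' (mem_insert_of_mem hj'X) hwj'
    rw [← hjg] at this
    exact hg (this ▸ hj'X)
  · refine mem_union_left _ (mem_sdiff.2 ⟨?_, hwg⟩)
    have hjX : j ∈ X := by
      rcases mem_insert.1 hjF with rfl | h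
      · exact absurd hwj hwg
      · exact h
    exact mem_bdry_of_unique I hjX hwj fun j' hj' hwj' => huniq j' (mem_insert_of_mem hj') hwj'

/-- **Counting form**: for any set `T` of variables of `g` on the boundary of `X`, `#bdry(X + g) + 2·#T ≤ #bdry X + 4`. -/
theorem card_bdry_insert_le_gen {X : Finset (Fin m)} {g : Fin m} (hg : g ∉ X) {T : Finset (Fin n)} (hT₁ : T ⊆ varSet I g)
    (hT₂ : T ⊆ bdry I X) : (bdry I (insert g X)).card + 2 * T.card ≤ (bdry I X).card + 4 := by
  classical
  have h := card_le_card (bdry_insert_subset_gen I hg)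
  have h1 : (bdry I X \ varSet I g).card ≤ (bdry I X).card - T.card := by
    have : bdry I X \ varSet I g ⊆ bdry I X \ T := sdiff_subset_sdiff (Subset.refl _) hT₁
    refine (card_le_card this).trans ?_
    rw [card_sdiff_of_subset hT₂]
  have h2 : ((varSet I g).filter fun w => ∀ j ∈ X, w ∉ varSet I j).card ≤ (varSet I g).card - T.card := by
    have : (varSet I g).filter (fun w => ∀ j ∈ X, w ∉ varSet I j) ⊆ varSet I g \ T := by
      intro w hw
      rw [mem_filter] at hw
      refine mem_sdiff.2 ⟨hw.1, fun hwT => ?_⟩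
      obtain ⟨j, hj, hwj⟩ := exists_mem_of_mem_bdry I (hT₂ hwT)
      exact hw.2 j hj hwj
    refine (card_le_card this).trans ?_
    rw [card_sdiff_of_subset hT₁]
  have h3 := card_varSet_le I g
  have h4 : T.card ≤ (bdry I X).card := card_le_card hT₂
  have h5 : T.card ≤ (varSet I g).card := card_le_card hT₁
  have h6 := card_union_le (bdry I X \ varSet I g) ((varSet I g).filter fun w => ∀ j ∈ X, w ∉ varSet I j)
  omega

end Bdry

/-! ## Tight cores: outside gates and no shared partners -/
section Tight

variable {I : LocalMap 4 n m} {r : ℕ} {y : Fin m → Bool} {J₀ : Finset (Fin m)} {w₁ w₂ : Finset (Fin n) × Finset (Fin m) × Bool}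

/-- A monomial output of the readers is not in the core, and fits in the radius together with the core. -/
theorem not_mem_and_card (ht : Terminal I r y J₀ w₁ w₂) {g : Fin m} (hg : g ∈ w₁.2.1 ∪ w₂.2.1) : g ∉ J₀ ∧ (insert g J₀).card ≤ r := by
  obtain ⟨-, -, -, hd₁, hd₂, hr, -, -⟩ := ht
  refine ⟨fun hgJ => ?_, (card_le_card ?_).trans hr⟩
  · rcases mem_union.1 hg with h | h
    exacts [disjoint_left.1 hd₁ hgJ h, disjoint_left.1 hd₂ hgJ h]
  · intro j hj
    rcases mem_insert.1 hj with rfl | hj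
    · rcases mem_union.1 hg with h | h
      · exact mem_union_left _ (mem_union_right _ h)
      · exact mem_union_right _ h
    · exact mem_union_left _ (mem_union_left _ hj)

/-- **Every chord of a tight terminal core is outside-gated.** -/
theorem outsideGated_of_tight (hB : BoundaryExpanding r I) (ht : Terminal I r y J₀ w₁ w₂) (htight : 2 * (bdry I J₀).card ≤ 3 * J₀.card)
    {c : Fin m} (hch : IsChord I J₀ c) : OutsideGated I J₀ (w₁.2.1 ∪ w₂.2.1) c := by
  intro g hg htouch
  obtain ⟨hgJ, hr⟩ := not_mem_and_card ht hg
  have fresh : ∀ {s s' : Fin 4}, 2 ≤ s.val → 2 ≤ s'.val → s ≠ s' → I.vars g s ∈ bdry I J₀ → ∀ j ∈ J₀, I.vars g s' ∉ varSet I j :=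
    fun hs hs' hne hb => partner_fresh_of_tight I hB hgJ hr htight hs hs' hne hb
  unfold PstarChordReadSwitches.Touches at htouch
  by_cases h22 : I.vars g 2 = I.vars c 2
  · exact ⟨I.vars c 2, I.vars g 3, Or.inl rfl, Or.inl ⟨h22, rfl⟩, fresh (s := 2) (s' := 3) (by decide) (by decide) (by decide) (h22 ▸ hch.1)⟩
  by_cases h32 : I.vars g 3 = I.vars c 2
  · exact ⟨I.vars c 2, I.vars g 2, Or.inl rfl, Or.inr ⟨rfl, h32⟩, fresh (s := 3) (s' := 2) (by decide) (by decide) (by decide) (h32 ▸ hch.1)⟩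
  by_cases h23 : I.vars g 2 = I.vars c 3
  · exact ⟨I.vars c 3, I.vars g 3, Or.inr rfl, Or.inl ⟨h23, rfl⟩, fresh (s := 2) (s' := 3) (by decide) (by decide) (by decide) (h23 ▸ hch.2)⟩
  by_cases h33 : I.vars g 3 = I.vars c 3
  · exact ⟨I.vars c 3, I.vars g 2, Or.inr rfl, Or.inr ⟨rfl, h33⟩, fresh (s := 3) (s' := 2) (by decide) (by decide) (by decide) (h33 ▸ hch.2)⟩
  exact absurd ⟨⟨h22, h32⟩, ⟨h23, h33⟩⟩ htouch

/-- **Two chords of a tight terminal core never share a partner** (typed instance): the two gates `(v, z)`, `(v', z)` would give `#J₀ + 2` outputs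
with boundary at most `#bdry J₀ + 2 < (3/2)(#J₀ + 2)`. -/
theorem no_shared_partner_of_tight (hT : Typed I) (hB : BoundaryExpanding r I) (ht : Terminal I r y J₀ w₁ w₂)
    (htight : 2 * (bdry I J₀).card ≤ 3 * J₀.card) {cᵢ cⱼ : Fin m} (hcᵢ : cᵢ ∈ J₀) (hcⱼ : cⱼ ∈ J₀) (hne : cᵢ ≠ cⱼ) (hchᵢ : IsChord I J₀ cᵢ)
    (hchⱼ : IsChord I J₀ cⱼ) :
    ∀ z, Partner I J₀ (w₁.2.1 ∪ w₂.2.1) cᵢ z → Partner I J₀ (w₁.2.1 ∪ w₂.2.1) cⱼ z → False := by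
  classical
  rintro z ⟨g, hg, v, hG⟩ ⟨g', hg', v', hG'⟩
  obtain ⟨hgJ, -⟩ := not_mem_and_card ht hg
  obtain ⟨hg'J, -⟩ := not_mem_and_card ht hg'
  -- the privates and the partner
  have memᵢ : v ∈ varSet I cᵢ ∧ v ∈ bdry I J₀ := by
    rcases hG.1 with e | e <;> rw [e]
    exacts [⟨vars_mem_varSet I cᵢ 2, hchᵢ.1⟩, ⟨vars_mem_varSet I cᵢ 3, hchᵢ.2⟩]
  have memⱼ : v' ∈ varSet I cⱼ ∧ v' ∈ bdry I J₀ := by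
    rcases hG'.1 with e | e <;> rw [e]
    exacts [⟨vars_mem_varSet I cⱼ 2, hchⱼ.1⟩, ⟨vars_mem_varSet I cⱼ 3, hchⱼ.2⟩]
  have hvv : v ≠ v' := fun e => not_mem_varSet_of_private I hcᵢ hcⱼ hne.symm memᵢ.2 memᵢ.1 (e ▸ memⱼ.1)
  have hvz : v ≠ z := hG.ne hcᵢ
  have hv'z : v' ≠ z := hG'.ne hcⱼ
  have hvg : v ∈ varSet I g := by
    rcases hG.2.1 with ⟨h2, -⟩ | ⟨-, h3⟩
    exacts [h2 ▸ vars_mem_varSet I g 2, h3 ▸ vars_mem_varSet I g 3]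
  have hzg : z ∈ varSet I g := by
    rcases hG.2.1 with ⟨-, h3⟩ | ⟨h2, -⟩
    exacts [h3 ▸ vars_mem_varSet I g 3, h2 ▸ vars_mem_varSet I g 2]
  have hv'g' : v' ∈ varSet I g' := by
    rcases hG'.2.1 with ⟨h2, -⟩ | ⟨-, h3⟩
    exacts [h2 ▸ vars_mem_varSet I g' 2, h3 ▸ vars_mem_varSet I g' 3]
  have hzg' : z ∈ varSet I g' := by
    rcases hG'.2.1 with ⟨-, h3⟩ | ⟨h2, -⟩
    exacts [h3 ▸ vars_mem_varSet I g' 3, h2 ▸ vars_mem_varSet I g' 2]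
  -- `v'` is not a variable of `g` (typed: not an XOR variable; not `v`, not `z`)
  have hv'g : v' ∉ varSet I g := by
    intro h
    unfold PstarSALevel.varSet at h
    obtain ⟨s, -, hs⟩ := mem_image.1 h
    obtain ⟨t, ht2, htv⟩ : ∃ t : Fin 4, 2 ≤ t.val ∧ I.vars cⱼ t = v' := by
      rcases hG'.1 with e | e
      exacts [⟨2, by decide, e.symm⟩, ⟨3, by decide, e.symm⟩]
    have h4 : ∀ u : Fin 4, u = 0 ∨ u = 1 ∨ u = 2 ∨ u = 3 := by decide
    rcases h4 s with rfl | rfl | rfl | rfl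
    · exact hT g cⱼ 0 t (by decide) ht2 (hs.trans htv.symm)
    · exact hT g cⱼ 1 t (by decide) ht2 (hs.trans htv.symm)
    · rcases hG.2.1 with ⟨h2, -⟩ | ⟨h2, -⟩
      · exact hvv (h2.symm.trans hs)
      · exact hv'z (hs.symm.trans h2)
    · rcases hG.2.1 with ⟨-, h3⟩ | ⟨-, h3⟩
      · exact hv'z (hs.symm.trans h3)
      · exact hvv (h3.symm.trans hs)
  -- the two gates are distinct
  have hgg : g' ≠ g := fun e => hv'g (e ▸ hv'g')
  have hg'X : g' ∉ insert g J₀ := fun h => by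
    rcases mem_insert.1 h with e | h
    exacts [hgg e, hg'J h]
  -- boundary counts
  have c₁ := card_bdry_insert_le_gen I hgJ (T := {v}) (singleton_subset_iff.2 hvg) (singleton_subset_iff.2 memᵢ.2)
  have hv'b : v' ∈ bdry I (insert g J₀) :=
    mem_bdry_of_unique I (mem_insert_of_mem hcⱼ) memⱼ.1 fun j' hj' hv'j' => by
      rcases mem_insert.1 hj' with rfl | hj'
      · exact absurd hv'j' hv'g
      · exact eq_of_mem_bdry I hj' hcⱼ memⱼ.2 hv'j' memⱼ.1
  have hzb : z ∈ bdry I (insert g J₀) :=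
    mem_bdry_of_unique I (mem_insert_self g J₀) hzg fun j' hj' hzj' => by
      rcases mem_insert.1 hj' with rfl | hj'
      · rfl
      · exact absurd hzj' (hG.2.2 j' hj')
  have c₂ := card_bdry_insert_le_gen I hg'X (T := {v', z})
    (insert_subset_iff.2 ⟨hv'g', singleton_subset_iff.2 hzg'⟩) (insert_subset_iff.2 ⟨hv'b, singleton_subset_iff.2 hzb⟩)
  rw [card_singleton] at c₁
  rw [card_pair hv'z] at c₂
  -- expansion on the `#J₀ + 2` outputs
  have hsub : insert g' (insert g J₀) ⊆ J₀ ∪ w₁.2.1 ∪ w₂.2.1 := by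
    intro j hj
    rcases mem_insert.1 hj with rfl | hj
    · rcases mem_union.1 hg' with h | h
      exacts [mem_union_left _ (mem_union_right _ h), mem_union_right _ h]
    rcases mem_insert.1 hj with rfl | hj
    · rcases mem_union.1 hg with h | h
      exacts [mem_union_left _ (mem_union_right _ h), mem_union_right _ h]
    · exact mem_union_left _ (mem_union_left _ hj)
  have hexp := hB _ ((card_le_card hsub).trans ht.2.2.2.2.2.1)
  rw [card_insert_of_notMem hg'X, card_insert_of_notMem hgJ] at hexp
  omega

/-- **A TIGHT terminal core has no two distinct slice-generic chords.** -/
theorem false_of_tight_two_generic (hI : I.IsPure xorAndPred) (hT : Typed I) (hS : SimpleOverlap I) (hB : BoundaryExpanding r I)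
    (ht : Terminal I r y J₀ w₁ w₂) (htight : 2 * (bdry I J₀).card ≤ 3 * J₀.card) {cᵢ cⱼ : Fin m} (hcᵢ : cᵢ ∈ J₀) (hcⱼ : cⱼ ∈ J₀)
    (hne : cᵢ ≠ cⱼ) (hchᵢ : IsChord I J₀ cᵢ) (hchⱼ : IsChord I J₀ cⱼ) (hgenᵢ : SliceGeneric I y J₀ cᵢ (w₁.2.1 ∪ w₂.2.1))
    (hgenⱼ : SliceGeneric I y J₀ cⱼ (w₁.2.1 ∪ w₂.2.1)) : False :=
  false_of_two_gated hI hT hS hB ht hcᵢ hcⱼ hne hchᵢ hchⱼ (outsideGated_of_tight hB ht htight hchᵢ) (outsideGated_of_tight hB ht htight hchⱼ)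
    (no_shared_partner_of_tight hT hB ht htight hcᵢ hcⱼ hne hchᵢ hchⱼ) hgenᵢ hgenⱼ

/-- **At maximal sharing** (`2·#sharedSlots = #J₀`, the regime of `TerminalFiveMaxSharing` and of the tight `k = 12` O1 structures) **a terminal core
has no two distinct slice-generic chords.** -/
theorem false_of_maxSharing_two_generic (hI : I.IsPure xorAndPred) (hT : Typed I) (hS : SimpleOverlap I) (hB : BoundaryExpanding r I)
    (ht : Terminal I r y J₀ w₁ w₂) (hmax : 2 * (sharedSlots I J₀).card = J₀.card) {cᵢ cⱼ : Fin m} (hcᵢ : cᵢ ∈ J₀) (hcⱼ : cⱼ ∈ J₀)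
    (hne : cᵢ ≠ cⱼ) (hchᵢ : IsChord I J₀ cᵢ) (hchⱼ : IsChord I J₀ cⱼ) (hgenᵢ : SliceGeneric I y J₀ cᵢ (w₁.2.1 ∪ w₂.2.1))
    (hgenⱼ : SliceGeneric I y J₀ cⱼ (w₁.2.1 ∪ w₂.2.1)) : False :=
  false_of_tight_two_generic hI hT hS hB ht (two_mul_card_bdry_le_of_maxSharing I ht.2.1 hmax) hcᵢ hcⱼ hne hchᵢ hchⱼ hgenᵢ hgenⱼ

end Tight

end Summit.PneNP.PneNP.Theorems.PstarChordReadTight
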